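/-
Copyright (c) 2026 the pub-hodgecm-mathlib formalisation cell (harness21).  Prover seat hodgecm-mathlib-K2Liu-p12 (g3): Track B «K2-LIT»,
#184♮ = hLiu418 = stmt-HodgeConjecture-24832; #42S payer road, organ S1, LAST FILE `K2LiuLocalSWParityOscillation` of K2Liu-p01 (g8) — brick (B) «the boxes `Λ_m`»
(LEAD F0P6-plan (g14) BATCH #15 (2) 2026-09-04T12:37:02Z; spec `K2/K2Liu-p01/g8/SPEC-F7-FrameStep.K2Liu-p01-g8.md` §1).
-/
import Summits.HodgeConjecture.HodgeConjecture.Theorems.K2LiuSkewLatticeShells               -- ★ F3b (K2Liu-p08): balls in `E ⊗ L⁺_v`-matrices, bridge to `𝔭_w^m` (+ ★ F3c-1 ball letter)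
import Summits.HodgeConjecture.HodgeConjecture.Theorems.K2LiuSkewLatticeHermitianCoordinates -- ★ E3b: `isUnit_det_gramS'`, skew = `𝕋₀⁻¹(ε•Herm)` coordinates
import HarnessLib

/-!
# Crux `HLiu418`, organ S1 (F7, inert parity oscillation), brick (B): THE DUAL BOXES `Λ_m = {t : δ̂·𝕋₀·t ∈ ϖ^{c₀−m}·L}` — additive subgroups, open, compact, nested, exhausting

Cell `hodgecm-mathlib`, crux item hLiu418 = `stmt-HodgeConjecture-24832`, route of record `HCCMUnconditional`; squad K2 ∕ K2Liu, road `K2_Liu`, #42S payer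
road, organ S1; consumer = K2Liu-p01 (g8)'s LAST FILE `K2LiuLocalSWParityOscillation` (bricks (J)(H)) and the assembler K2Liu-p06 (g4) (★ F3e
`K2LiuLocalSWCoordinateLattices`: `Λ : AddSubgroup (Matrix (Fin n) (Fin n) (LocalRing E v))`, `Λ₀` OPEN, `Λ` COMPACT).  THEOREMS ONLY (no `def`, no `instance`,
no `notation`, no named-fact hypothesis, no `sorry`); lane `--supports stmt-HodgeConjecture-24832` (count-neutral helper; closes no socket by itself).

THE MATHEMATICS (p01's SPEC §1 «FIX: choose the boxes through the dual lattice»).  `L ⊂ Herm₂(E_w)` is the `τ`-dual of `Herm₂(𝒪_E)`: diagonal entries in `2⁻¹ι(𝒪_v)`,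
off-diagonal entries in `𝒪_E`; `Λ₀ := ϖ^{c₀}(δ̂𝕋₀)⁻¹L`, `Λ_m := ϖ^{−m}Λ₀`, `c₀ = m_ψ + v(2) + v(d)`.  In the E-det BALL CURRENCY of ★ F3c-1 (`∀ i j w, |x_ij|_w ≤ |ι_w ϖ|_w^a`) and in the
FULL matrix space `M₂(E ⊗ L⁺_v)` (as ★ F3e wants), with the valuation of `2` carried by the exponent letter `e₂` and `c₀ : ℤ` a parameter:
  **`BOX m := {t | ∀ i j w, |(δ̂·(𝕋₀·t))_ij|_w ≤ |ι_w ϖ|_w^{c₀ − m − [i = j]·e₂}}`**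
(for SKEW `t`, `H = δ̂𝕋₀t` is Hermitian, so `H_ii ∈ ι(L⁺_v)` and the diagonal condition IS «`H_ii ∈ 2⁻¹ϖ^{c₀−m}ι(𝒪_v)`»; off the skew lattice the box is just a convenient open
compact neighbourhood, which is all ★ F3e uses).
* §1 `exists_addSubgroup_box` (an additive subgroup with carrier `BOX m`: ultrametric balls), `zero_mem_box`, `box_mono` (nested in `m`), `exists_mem_box` (exhausting);
* §2 `isOpen_box` (finitely many open coordinate conditions pulled back along the continuous `t ↦ δ̂·𝕋₀·t`), `box_subset_mball` (`BOX m ⊆` the plain ball of exponent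
  `c₀ − m − e₂` when `𝕋₀⁻¹` is integral and `δ̂` is a unit at `v` — the E6 letters `hTib`, `hδu`), `isCompact_box`.
The index `|𝔰_{Λ_m} ⧸ 𝔰_{Λ₀}| = q_v^{4m}` on the SKEW part (via ★ E3b's coordinates `(a, b, z)`) is the sequel brick (B5), typed to the consumer's currency.
HONEST LABEL.  Count-neutral helper; it retires nothing by itself: `HC_CM` is proved only modulo the 7 printed citations (2 remaining named inputs:
hLiu418 = `stmt-HodgeConjecture-24832`, h413 = `stmt-HodgeConjecture-24833`) until rung 0 closes.

## References
* [Shimura1997] G. Shimura, CBMS 93 (1997): §13 (dual lattices of Hermitian forms over local fields), §18.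
* [CasselsFrohlichANT1967] Cassels–Fröhlich, *Algebraic Number Theory* (1967): Ch. II §10 (balls `𝔭^m`, ultrametric inequality).
* [BushnellHenniart2006] C. Bushnell, G. Henniart, *The Local Langlands Conjecture for GL(2)* (2006): §1.1 (lattices, compact open subgroups).
-/

set_option autoImplicit false
-- the mandated namespace repeats the single-problem summit's segment (`HodgeConjecture.HodgeConjecture`)
set_option linter.dupNamespace false

noncomputable section

open scoped NNReal ENNReal Topology Matrix
open NumberField IsDedekindDomain Matrix MeasureTheory Set
open Literature.NumberTheory.GaloisRepresentations.IsNonarchimedeanLocalField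
open Literature.NumberTheory.Automorphic Literature.NumberTheory.Automorphic.UnitaryGroup
open Literature.NumberTheory.GelbartRogawski1991.AdaptedBlocks
open Literature.NumberTheory.GelbartRogawski1991.UnitaryDualPair.LocalSplitting
open Literature.NumberTheory.K2Lit.LocalSiegelDoubled
open Summit.HodgeConjecture.HodgeConjecture.Cruxes.HLiu418.K2LiuLocalRingValuationBalls
open Summit.HodgeConjecture.HodgeConjecture.Cruxes.HLiu418.K2LiuSkewLatticeShells

namespace Summit.HodgeConjecture.HodgeConjecture.Cruxes.HLiu418.K2LiuLocalSWDualBoxes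

variable (F : Type) [Field F] [NumberField F] (E : Type) [Field E] [NumberField E] [Algebra F E]
  (v : HeightOneSpectrum (𝓞 F)) {π : v.adicCompletion F} (hπ : Valued.v π = WithZero.exp (-1 : ℤ))
  {T₀ : Matrix (Fin 2) (Fin 2) F} (δ : E) (c₀ e₂ : ℤ)

/-! ## §1 The boxes are nested, exhausting additive subgroups -/

/-- **`BOX m` is (the carrier of) an additive subgroup of `M₂(E ⊗ L⁺_v)`** (`t ↦ δ̂·𝕋₀·t` is additive; every coordinate condition is an ultrametric ball ★ `ball_add`∕`ball_neg`∕`ball_zero`).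
[cite: CasselsFrohlichANT1967, Ch. II §10] -/
theorem exists_addSubgroup_box (m : ℤ) :
    ∃ Λ : AddSubgroup (Matrix (Fin 2) (Fin 2) (LocalRing E v)), (Λ : Set (Matrix (Fin 2) (Fin 2) (LocalRing E v))) =
      {t | ∀ i j (w : PlacesOver E v), Valued.v ((algebraMap E (LocalRing E v) δ • (gramS F E v 2 T₀ * t)) i j w) ≤
        Valued.v (toPlace v w π) ^ (c₀ - m - if i = j then e₂ else 0)} := by
  let P : Matrix (Fin 2) (Fin 2) (LocalRing E v) → Prop := fun t => ∀ i j (w : PlacesOver E v),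
    Valued.v ((algebraMap E (LocalRing E v) δ • (gramS F E v 2 T₀ * t)) i j w) ≤ Valued.v (toPlace v w π) ^ (c₀ - m - if i = j then e₂ else 0)
  have hadd : ∀ {t t' : Matrix (Fin 2) (Fin 2) (LocalRing E v)}, P t → P t' → P (t + t') := fun {t t'} ht ht' i j w => by
    rw [Matrix.mul_add, smul_add, Matrix.add_apply]
    exact ball_add F E v (ht i j) (ht' i j) w
  have hzero : P 0 := fun i j w => by
    rw [Matrix.mul_zero, smul_zero, Matrix.zero_apply]
    exact ball_zero F E v _ w
  have hneg : ∀ {t : Matrix (Fin 2) (Fin 2) (LocalRing E v)}, P t → P (-t) := fun {t} ht i j w => by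
    rw [Matrix.mul_neg, smul_neg, Matrix.neg_apply]
    exact ball_neg F E v (ht i j) w
  exact ⟨{ carrier := setOf P, add_mem' := fun ha hb => hadd ha hb, zero_mem' := hzero, neg_mem' := fun ha => hneg ha }, rfl⟩

/-- `0 ∈ BOX m`. [cite: CasselsFrohlichANT1967, Ch. II §10] -/
theorem zero_mem_box (m : ℤ) :
    (0 : Matrix (Fin 2) (Fin 2) (LocalRing E v)) ∈
      {t : Matrix (Fin 2) (Fin 2) (LocalRing E v) | ∀ i j (w : PlacesOver E v), Valued.v ((algebraMap E (LocalRing E v) δ • (gramS F E v 2 T₀ * t)) i j w) ≤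
        Valued.v (toPlace v w π) ^ (c₀ - m - if i = j then e₂ else 0)} := fun i j w => by
  rw [Matrix.mul_zero, smul_zero, Matrix.zero_apply]
  exact ball_zero F E v _ w

include hπ in
/-- **the boxes are NESTED**: `m ≤ m' ⇒ BOX m ⊆ BOX m'` (the exponents decrease, ★ `ball_antitone`). [cite: BushnellHenniart2006, §1.1] -/
theorem box_mono {m m' : ℤ} (h : m ≤ m') :
    {t : Matrix (Fin 2) (Fin 2) (LocalRing E v) | ∀ i j (w : PlacesOver E v), Valued.v ((algebraMap E (LocalRing E v) δ • (gramS F E v 2 T₀ * t)) i j w) ≤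
        Valued.v (toPlace v w π) ^ (c₀ - m - if i = j then e₂ else 0)} ⊆
      {t | ∀ i j (w : PlacesOver E v), Valued.v ((algebraMap E (LocalRing E v) δ • (gramS F E v 2 T₀ * t)) i j w) ≤
        Valued.v (toPlace v w π) ^ (c₀ - m' - if i = j then e₂ else 0)} :=
  fun _ ht i j => ball_antitone F E v hπ (by linarith) (ht i j)

include hπ in
/-- **the boxes EXHAUST** `M₂(E ⊗ L⁺_v)`: every `t` lies in some `BOX m` (each of the finitely many coordinates of `δ̂·𝕋₀·t` lies in some ball ★ `exists_le_zpow_of_le_exp_neg_one`;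
take `m` beyond all of them). [cite: BushnellHenniart2006, §1.1] -/
theorem exists_mem_box (t : Matrix (Fin 2) (Fin 2) (LocalRing E v)) :
    ∃ m : ℤ, t ∈ {t : Matrix (Fin 2) (Fin 2) (LocalRing E v) | ∀ i j (w : PlacesOver E v),
      Valued.v ((algebraMap E (LocalRing E v) δ • (gramS F E v 2 T₀ * t)) i j w) ≤ Valued.v (toPlace v w π) ^ (c₀ - m - if i = j then e₂ else 0)} := by
  choose a ha using fun ijw : Fin 2 × Fin 2 × PlacesOver E v =>
    exists_le_zpow_of_le_exp_neg_one (valued_toPlace_uniformizer_ne_zero F E v hπ ijw.2.2) (valued_toPlace_uniformizer_le F E v hπ ijw.2.2)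
      (Valued.v ((algebraMap E (LocalRing E v) δ • (gramS F E v 2 T₀ * t)) ijw.1 ijw.2.1 ijw.2.2))
  obtain ⟨a₀, ha₀⟩ := Finite.bddBelow_range a
  refine ⟨c₀ + |e₂| - a₀, fun i j w => (ha (i, j, w)).trans (zpow_le_zpow_right_of_le_one₀ (zero_lt_iff.2 (valued_toPlace_uniformizer_ne_zero F E v hπ w))
    (valued_toPlace_uniformizer_le_one F E v hπ w) ?_)⟩
  have h1 : a₀ ≤ a (i, j, w) := ha₀ ⟨(i, j, w), rfl⟩
  have h2 : -|e₂| ≤ (if i = j then e₂ else 0) ∧ (if i = j then e₂ else 0) ≤ |e₂| := by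
    split_ifs
    · exact ⟨neg_abs_le e₂, le_abs_self e₂⟩
    · exact ⟨by simp, abs_nonneg e₂⟩
  omega

/-! ## §2 Open; inside a plain ball; compact -/

include hπ in
/-- **`BOX m` is OPEN** (pull-back of finitely many open coordinate conditions ★ `isOpen_setOf_valued_le` along the continuous `t ↦ δ̂·(𝕋₀·t)`).
[cite: BushnellHenniart2006, §1.1] -/
theorem isOpen_box (m : ℤ) :
    IsOpen {t : Matrix (Fin 2) (Fin 2) (LocalRing E v) | ∀ i j (w : PlacesOver E v),
      Valued.v ((algebraMap E (LocalRing E v) δ • (gramS F E v 2 T₀ * t)) i j w) ≤ Valued.v (toPlace v w π) ^ (c₀ - m - if i = j then e₂ else 0)} := by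
  have hcont : Continuous fun t : Matrix (Fin 2) (Fin 2) (LocalRing E v) => algebraMap E (LocalRing E v) δ • (gramS F E v 2 T₀ * t) :=
    (continuous_const_smul (algebraMap E (LocalRing E v) δ)).comp (continuous_const.matrix_mul continuous_id)
  have h : {t : Matrix (Fin 2) (Fin 2) (LocalRing E v) | ∀ i j (w : PlacesOver E v),
      Valued.v ((algebraMap E (LocalRing E v) δ • (gramS F E v 2 T₀ * t)) i j w) ≤ Valued.v (toPlace v w π) ^ (c₀ - m - if i = j then e₂ else 0)} =
      ⋂ i : Fin 2, ⋂ j : Fin 2, ⋂ w : PlacesOver E v, (fun t => (algebraMap E (LocalRing E v) δ • (gramS F E v 2 T₀ * t)) i j w) ⁻¹'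
        {x : w.1.adicCompletion E | Valued.v x ≤ Valued.v (toPlace v w π) ^ (c₀ - m - if i = j then e₂ else 0)} := by
    ext t; simp only [Set.mem_setOf_eq, Set.mem_iInter, Set.mem_preimage]
  rw [h]
  exact isOpen_iInter_of_finite fun i => isOpen_iInter_of_finite fun j => isOpen_iInter_of_finite fun w =>
    (isOpen_setOf_valued_le F E v hπ _ w).preimage (((continuous_apply w).comp ((continuous_apply j).comp ((continuous_apply i).comp hcont))))

include hπ in
/-- **`BOX m` LIES IN A PLAIN BALL**: if `𝕋₀⁻¹` is `v`-integral (`hTib`) and `δ̂` is a `v`-unit (`hδu`) — the E6 letters — then every `t ∈ BOX m` has all coordinates in the ball of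
exponent `c₀ − m − |e₂|` (`t = 𝕋₀⁻¹·(𝕋₀t)`, `|(𝕋₀t)_ij|_w = |(δ̂𝕋₀t)_ij|_w`, ★ `mball_mul`). [cite: CasselsFrohlichANT1967, Ch. II §10] -/
theorem box_subset_mball (hT₀d : IsUnit T₀.det)
    (hTib : ∀ i j (w : PlacesOver E v), Valued.v ((gramS F E v 2 T₀)⁻¹ i j w) ≤ Valued.v (toPlace v w π) ^ (0 : ℤ))
    (hδu : ∀ w : PlacesOver E v, Valued.v (algebraMap E (LocalRing E v) δ w) = 1) (m : ℤ) :
    {t : Matrix (Fin 2) (Fin 2) (LocalRing E v) | ∀ i j (w : PlacesOver E v),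
      Valued.v ((algebraMap E (LocalRing E v) δ • (gramS F E v 2 T₀ * t)) i j w) ≤ Valued.v (toPlace v w π) ^ (c₀ - m - if i = j then e₂ else 0)} ⊆
      {t | ∀ i j (w : PlacesOver E v), Valued.v (t i j w) ≤ Valued.v (toPlace v w π) ^ (c₀ - m - |e₂|)} := by
  intro t ht
  -- `𝕋₀ t` lies in the ball of exponent `c₀ − m − |e₂|`
  have hTt : ∀ i j (w : PlacesOver E v), Valued.v ((gramS F E v 2 T₀ * t) i j w) ≤ Valued.v (toPlace v w π) ^ (c₀ - m - |e₂|) := by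
    intro i j w
    have h1 := ht i j w
    rw [Matrix.smul_apply, smul_eq_mul, Pi.mul_apply, map_mul, hδu w, one_mul] at h1
    refine h1.trans (zpow_le_zpow_right_of_le_one₀ (zero_lt_iff.2 (valued_toPlace_uniformizer_ne_zero F E v hπ w))
      (valued_toPlace_uniformizer_le_one F E v hπ w) ?_)
    have h2 : -|e₂| ≤ (if i = j then e₂ else 0) ∧ (if i = j then e₂ else 0) ≤ |e₂| := by
      split_ifs
      · exact ⟨neg_abs_le e₂, le_abs_self e₂⟩
      · exact ⟨by simp, abs_nonneg e₂⟩
    omega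
  have ht' : t = (gramS F E v 2 T₀)⁻¹ * (gramS F E v 2 T₀ * t) :=
    (Matrix.nonsing_inv_mul_cancel_left (gramS F E v 2 T₀) t (isUnit_det_gramS' F E v 2 hT₀d)).symm
  intro i j w
  rw [ht']
  simpa only [zero_add] using mball_mul F E v hπ hTib hTt i j w

include hπ in
/-- **`BOX m` is COMPACT** (closed — finitely many closed coordinate conditions pulled back continuously — inside the compact plain ball of `box_subset_mball`, a product of compact
coordinate balls ★ `isCompact_setOf_valued_le`). [cite: BushnellHenniart2006, §1.1] -/
theorem isCompact_box (hT₀d : IsUnit T₀.det)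
    (hTib : ∀ i j (w : PlacesOver E v), Valued.v ((gramS F E v 2 T₀)⁻¹ i j w) ≤ Valued.v (toPlace v w π) ^ (0 : ℤ))
    (hδu : ∀ w : PlacesOver E v, Valued.v (algebraMap E (LocalRing E v) δ w) = 1) (m : ℤ) :
    IsCompact {t : Matrix (Fin 2) (Fin 2) (LocalRing E v) | ∀ i j (w : PlacesOver E v),
      Valued.v ((algebraMap E (LocalRing E v) δ • (gramS F E v 2 T₀ * t)) i j w) ≤ Valued.v (toPlace v w π) ^ (c₀ - m - if i = j then e₂ else 0)} := by
  -- the compact plain ball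
  have hK : IsCompact (Set.univ.pi fun _ : Fin 2 => Set.univ.pi fun _ : Fin 2 =>
      Set.univ.pi fun w : PlacesOver E v => {x : w.1.adicCompletion E | Valued.v x ≤ Valued.v (toPlace v w π) ^ (c₀ - m - |e₂|)}) :=
    isCompact_univ_pi fun _ => isCompact_univ_pi fun _ => isCompact_univ_pi fun w => isCompact_setOf_valued_le F E v hπ _ w
  have hsub : {t : Matrix (Fin 2) (Fin 2) (LocalRing E v) | ∀ i j (w : PlacesOver E v),
      Valued.v ((algebraMap E (LocalRing E v) δ • (gramS F E v 2 T₀ * t)) i j w) ≤ Valued.v (toPlace v w π) ^ (c₀ - m - if i = j then e₂ else 0)} ⊆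
      Set.univ.pi fun _ : Fin 2 => Set.univ.pi fun _ : Fin 2 =>
        Set.univ.pi fun w : PlacesOver E v => {x : w.1.adicCompletion E | Valued.v x ≤ Valued.v (toPlace v w π) ^ (c₀ - m - |e₂|)} :=
    fun t ht i _ j _ w _ => box_subset_mball F E v hπ δ c₀ e₂ hT₀d hTib hδu m ht i j w
  -- the box is closed
  have hcont : Continuous fun t : Matrix (Fin 2) (Fin 2) (LocalRing E v) => algebraMap E (LocalRing E v) δ • (gramS F E v 2 T₀ * t) :=
    (continuous_const_smul (algebraMap E (LocalRing E v) δ)).comp (continuous_const.matrix_mul continuous_id)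
  have h : {t : Matrix (Fin 2) (Fin 2) (LocalRing E v) | ∀ i j (w : PlacesOver E v),
      Valued.v ((algebraMap E (LocalRing E v) δ • (gramS F E v 2 T₀ * t)) i j w) ≤ Valued.v (toPlace v w π) ^ (c₀ - m - if i = j then e₂ else 0)} =
      ⋂ i : Fin 2, ⋂ j : Fin 2, ⋂ w : PlacesOver E v, (fun t => (algebraMap E (LocalRing E v) δ • (gramS F E v 2 T₀ * t)) i j w) ⁻¹'
        {x : w.1.adicCompletion E | Valued.v x ≤ Valued.v (toPlace v w π) ^ (c₀ - m - if i = j then e₂ else 0)} := by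
    ext t; simp only [Set.mem_setOf_eq, Set.mem_iInter, Set.mem_preimage]
  have hclosed : IsClosed {t : Matrix (Fin 2) (Fin 2) (LocalRing E v) | ∀ i j (w : PlacesOver E v),
      Valued.v ((algebraMap E (LocalRing E v) δ • (gramS F E v 2 T₀ * t)) i j w) ≤ Valued.v (toPlace v w π) ^ (c₀ - m - if i = j then e₂ else 0)} := by
    rw [h]
    exact isClosed_iInter fun i => isClosed_iInter fun j => isClosed_iInter fun w =>
      ((isCompact_setOf_valued_le F E v hπ _ w).isClosed).preimage
        (((continuous_apply w).comp ((continuous_apply j).comp ((continuous_apply i).comp hcont))))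
  exact hK.of_isClosed_subset hclosed hsub

end Summit.HodgeConjecture.HodgeConjecture.Cruxes.HLiu418.K2LiuLocalSWDualBoxes

end
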